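import Mathlib.NumberTheory.Bertrand
import Literature.Computability.Cryptography.PseudorandomPermutations
import Literature.Computability.Complexity.StackUnaryBits
import HarnessLib

/-!
# Zhandry's modified pseudorandom function `PRF^mod` and Aaronson–Chen 2017, Lemma 7.5 (1)

Topic `Literature/Computability/Cryptography`. This file vendors the CONSTRUCTION of §7.2 of
S. Aaronson, L. Chen, *Complexity-theoretic foundations of quantum supremacy experiments*, CCC 2017
(arXiv:1612.05903, whose numbering we follow) [AaronsonChen2017] — taken there from M. Zhandry,
*How to construct quantum random functions*, FOCS 2012, Claims 1–2 — and the CLASSICAL half of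
their Lemma 7.5 as named facts, in the vocabulary of the tree's PRF/PRP game
(`PseudorandomFunctions.lean`, `PseudorandomPermutations.lean`, `OracleGames.lean`). It is the first
layer below the leaf `Literature.Barriers.QuantumAdvantage.aaronsonChen2017_thm76_of_prp`
(`PRPExist → PPolyOracleSeparation`, the content of Aaronson–Chen's Thm. 7.6 once a secure PRP is
given) of `Literature/Barriers/QuantumAdvantage/PPolyOraclesProofs.lean`.

**The printed text** (arXiv v2, read via `lit read arxiv:1612.05903`).

* §7.2 (p. 29): "Assuming one-way functions exist, by Lemma 7.4, let `PRP^raw` be a secure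
  pseudorandom permutation with key-space `K^raw` and domain `X^raw`. We interpret `X^raw` as `[N]`,
  where `N = N(n) = |X^raw|`. Then we define another pseudorandom function
  `PRF^mod_{(k,a)}(x) = PRP^raw_k((x − 1) mod a + 1)` where: the key space of `PRF^mod` is
  `K^mod = K^raw × A` where `A` is the set of primes in `[√N/4, √N/2]`; the domain and image are
  both `X^raw`."
* Lemma 7.5 (p. 30; "Implicit in Claim 1 and Claim 2 of [Zhandry 2012]"), first item: "Both
  `PRP^raw` and `PRF^mod` are classical secure PRFs. Consequently, no classical algorithm `A` can
  distinguish them with a non-negligible advantage." Its proof (App. 13, p. 42): "It is well-known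
  that a secure PRP is also a secure PRF; therefore `PRP^raw` is a classically-secure PRF" and, for
  `PRF^mod`, a switching step (`PRP^raw ↦` truly random `f`) followed by "as long as `A` never
  queries its oracle on two points `x` and `x'` such that `x ≡ x' (mod a)`, the oracle will look
  random … each difference can be divisible by at most two different moduli … the total probability
  … is at most `O(q² log N/√N)`", concluding
  "`|Pr_{f ← PRF^mod_{K^mod}}[A^f() = 1] − Pr_{f ← X^X}[A^f() = 1]| < ε` for any polynomial-time
  algorithm `A`."

**What this file adds.**

* `zhandryModuli N` — the moduli set `A`: the primes in `[√N/4, √N/2]` (natural-number floors: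
  `Nat.sqrt N / 4 ≤ a ≤ Nat.sqrt N / 2`), nonempty as soon as `N ≥ 16` (`zhandryModuli_nonempty`,
  Bertrand's postulate);
* `modReduce ℓ a`, `prfMod F ℓ n k a` — Zhandry's `PRF^mod` over a function ensemble `F` with block
  length `ℓ`: on the tree's domain `{0,1}^{ℓ n} ≅ [0, 2^{ℓ n})` (little-endian value `bitsToNat`,
  fixed-width digits `natBits`) the printed `(x − 1) mod a + 1` on `[N] = {1, …, N}` becomes
  `x ↦ x mod a` (the same map conjugated by the bijection `x ↦ x + 1`);
* `prfModRealProb F κ ℓ 𝒜 n = Pr_{(k,a) ← K^raw × A}[𝒜^{PRF^mod_{(k,a)}}(1ⁿ) = 1]` (a finite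
  average, uniform `(k, a) ∈ {0,1}^{κ n} × A`) and `prfModAdvantage` (against the ideal random
  function game `prfIdealProb ℓ ℓ` of the tree);
* the two printed assertions of Lemma 7.5 (1) as named facts: `aaronsonChen2017_lem75_prp_isPRF`
  (a secure PRP with block length `ℓ n ≥ n` is a secure PRF — the switching lemma) and
  `aaronsonChen2017_lem75_prfMod_isPRF` (`PRF^mod` is a classically secure PRF);
* proved API: `prfRealProb_eq_sum` (the tree's real PRF game as a finite average over the keys),
  bounds, periodicity of `prfMod` (`prfMod_eq_of_mod_eq`), and the printed "Consequently":
  `aaronsonChen2017_lem75_indist` (`PRP^raw` and `PRF^mod` are indistinguishable by PPT oracle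
  adversaries, from the two facts and the triangle inequality) with its `ε`-form
  `aaronsonChen2017_lem75_eventually_le`.

## Design notes

* Keys of `PRF^mod` are pairs `(k, a)`; the tree's `IsPRF` draws keys from `uniformBits`, so the
  security of `PRF^mod` is stated directly as the decay of `prfModAdvantage` (uniform `(k, a)` over
  the finite product `{0,1}^{κ n} × A`, exactly the printed `(k, a) ← K^mod`), not through `IsPRF`.
* When `A = ∅` (only for `2^{ℓ n} < 16`) the average `prfModRealProb` is `0` by the `x / 0 = 0`
  convention; all statements are asymptotic in `n` and consumers assume `n ≤ ℓ n`.
* Security is against the tree's CLASSICAL uniform PPT oracle adversaries (`OracleAdversary.IsPPT`),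
  as printed ("classical secure PRFs"; Def. 7.2).

## Sources

* [AaronsonChen2017] arXiv:1612.05903: §7.1 Def. 7.1–7.2, Lemma 7.4 (p. 29); §7.2 and Lemma 7.5
  (pp. 29–30); App. 13, proof of Lemma 7.5 (p. 42).
* [Zhandry2012] M. Zhandry, *How to construct quantum random functions*, FOCS 2012, Claims 1–2 (the
  original construction; cited through [AaronsonChen2017]).
* Mathlib: `Nat.exists_prime_lt_and_le_two_mul` (Bertrand), `Nat.sqrt`, `PMF.bind_map`,
  `Asymptotics.SuperpolynomialDecay`.
-/

namespace Literature.Computability.Cryptography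

open Filter Asymptotics _root_.Computability Complexity Finset

/-! ### The moduli set `A`: primes in `[√N/4, √N/2]` -/

/-- The moduli of Zhandry's construction for domain size `N`: the primes `a` with
`⌊√N⌋/4 ≤ a ≤ ⌊√N⌋/2` (natural-number division). [cite: AaronsonChen2017, §7.2 (p. 29)] -/
def zhandryModuli (N : ℕ) : Finset ℕ :=
  (Finset.Icc (Nat.sqrt N / 4) (Nat.sqrt N / 2)).filter Nat.Prime

/-- Membership in the moduli set. [cite: AaronsonChen2017, §7.2 (p. 29)] -/
theorem mem_zhandryModuli {N a : ℕ} :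
    a ∈ zhandryModuli N ↔ Nat.sqrt N / 4 ≤ a ∧ a ≤ Nat.sqrt N / 2 ∧ a.Prime := by
  simp [zhandryModuli, and_assoc]

/-- Moduli are prime. [cite: AaronsonChen2017, §7.2 (p. 29)] -/
theorem prime_of_mem_zhandryModuli {N a : ℕ} (h : a ∈ zhandryModuli N) : a.Prime :=
  (mem_zhandryModuli.1 h).2.2

/-- Moduli are positive. [cite: AaronsonChen2017, §7.2 (p. 29)] -/
theorem pos_of_mem_zhandryModuli {N a : ℕ} (h : a ∈ zhandryModuli N) : 0 < a :=
  (prime_of_mem_zhandryModuli h).pos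

/-- Moduli are at most `√N / 2`, in particular at most `√N`. [cite: AaronsonChen2017, §7.2 (p. 29)] -/
theorem le_sqrt_of_mem_zhandryModuli {N a : ℕ} (h : a ∈ zhandryModuli N) : a ≤ Nat.sqrt N :=
  (mem_zhandryModuli.1 h).2.1.trans (Nat.div_le_self _ _)

/-- Moduli are at most `N` (so reduction modulo `a` stays inside `[0, N)` for `N ≥ 1`).
[cite: AaronsonChen2017, §7.2 (p. 29)] -/
theorem le_of_mem_zhandryModuli {N a : ℕ} (h : a ∈ zhandryModuli N) : a ≤ N :=
  (le_sqrt_of_mem_zhandryModuli h).trans (Nat.sqrt_le_self N)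

/-- `a² ≤ N` for every modulus (the regime `N ≥ a²` of period finding). [cite: AaronsonChen2017, §7.2 (p. 29)] -/
theorem sq_le_of_mem_zhandryModuli {N a : ℕ} (h : a ∈ zhandryModuli N) : a * a ≤ N :=
  Nat.le_sqrt.1 (le_sqrt_of_mem_zhandryModuli h)

/-- **The moduli set is nonempty once `N ≥ 16`** (Bertrand's postulate between `⌊√N⌋/4 ≥ 1` and
its double `≤ ⌊√N⌋/2`; the paper uses the prime number theorem, `|A| = Ω(√N / log N)`).
[cite: AaronsonChen2017, App. 13 (p. 42)] -/
theorem zhandryModuli_nonempty {N : ℕ} (hN : 16 ≤ N) : (zhandryModuli N).Nonempty := by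
  have hs : 4 ≤ Nat.sqrt N := by
    rw [Nat.le_sqrt]
    omega
  obtain ⟨p, hp, hlt, hle⟩ := Nat.exists_prime_lt_and_le_two_mul (Nat.sqrt N / 4) (by omega)
  exact ⟨p, mem_zhandryModuli.2 ⟨hlt.le, by omega, hp⟩⟩

/-- In terms of the block length: nonempty as soon as `ℓ ≥ 4`. [cite: AaronsonChen2017, App. 13 (p. 42)] -/
theorem zhandryModuli_two_pow_nonempty {ℓ : ℕ} (hℓ : 4 ≤ ℓ) : (zhandryModuli (2 ^ ℓ)).Nonempty :=
  zhandryModuli_nonempty (le_trans (by norm_num) (Nat.pow_le_pow_right (by norm_num) hℓ))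

/-! ### The construction `PRF^mod` -/

/-- Reduction modulo `a` on `ℓ`-bit strings read as little-endian numbers in `[0, 2^ℓ)`:
`x ↦ natBits ℓ (bitsToNat x mod a)` (the printed `x ↦ (x − 1) mod a + 1` on `[N] = {1,…,N}`,
transported to `[0, N)`). [cite: AaronsonChen2017, §7.2 (p. 29)] -/
def modReduce (ℓ a : ℕ) (x : List Bool) : List Bool :=
  Complexity.natBits ℓ (bitsToNat x % a)

/-- **Zhandry's modified function** `PRF^mod_{(k,a)}(x) = PRP^raw_k(x mod a)` over the function
ensemble `F` (the `PRP^raw` of the paper) with block length `ℓ`: security parameter `n`, key part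
`k`, modulus `a`, input `x ∈ {0,1}^{ℓ n}`. [cite: AaronsonChen2017, §7.2 (p. 29)] -/
def prfMod (F : FunctionEnsemble) (ℓ : ℕ → ℕ) (n : ℕ) (k : List Bool) (a : ℕ) (x : List Bool) :
    List Bool :=
  F n k (modReduce (ℓ n) a x)

/-- `modReduce ℓ a x` has length `ℓ`. [folklore] -/
@[simp] theorem length_modReduce (ℓ a : ℕ) (x : List Bool) : (modReduce ℓ a x).length = ℓ :=
  Complexity.length_natBits _ _

/-- The value of `modReduce ℓ a x` is `x mod a` (for `0 < a ≤ 2^ℓ`). [cite: AaronsonChen2017, §7.2 (p. 29)] -/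
theorem bitsToNat_modReduce {ℓ a : ℕ} (ha : 0 < a) (haℓ : a ≤ 2 ^ ℓ) (x : List Bool) :
    bitsToNat (modReduce ℓ a x) = bitsToNat x % a :=
  Complexity.bitsToNat_natBits (lt_of_lt_of_le (Nat.mod_lt _ ha) haℓ)

/-- `modReduce` only depends on the residue of the input modulo `a`. [cite: AaronsonChen2017, §7.2 (p. 29)] -/
theorem modReduce_eq_of_mod_eq {ℓ a : ℕ} {x x' : List Bool} (h : bitsToNat x % a = bitsToNat x' % a) :
    modReduce ℓ a x = modReduce ℓ a x' := by
  simp [modReduce, h]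

/-- **Periodicity of `PRF^mod`**: inputs congruent modulo `a` have the same value ("`f = g_{mod a}`
has a unique period `a`", App. 13). [cite: AaronsonChen2017, App. 13 (p. 42)] -/
theorem prfMod_eq_of_mod_eq (F : FunctionEnsemble) (ℓ : ℕ → ℕ) (n : ℕ) (k : List Bool) (a : ℕ)
    {x x' : List Bool} (h : bitsToNat x % a = bitsToNat x' % a) :
    prfMod F ℓ n k a x = prfMod F ℓ n k a x' := by
  simp [prfMod, modReduce_eq_of_mod_eq h]

/-- `PRF^mod` factors through `PRP^raw` on the reduced input (definitional). [cite: AaronsonChen2017, §7.2 (p. 29)] -/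
theorem prfMod_apply (F : FunctionEnsemble) (ℓ : ℕ → ℕ) (n : ℕ) (k : List Bool) (a : ℕ)
    (x : List Bool) : prfMod F ℓ n k a x = F n k (modReduce (ℓ n) a x) :=
  rfl

/-- Under a well-formed key, `PRF^mod` maps into `{0,1}^{ℓ n}` ("the domain and image are both
`X^raw`"). [cite: AaronsonChen2017, §7.2 (p. 29)] -/
theorem length_prfMod {F : FunctionEnsemble} {κ ℓ : ℕ → ℕ} (hF : IsEfficientFamily F κ ℓ ℓ)
    (n : ℕ) {k : List Bool} (hk : k.length = κ n) (a : ℕ) (x : List Bool) :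
    (prfMod F ℓ n k a x).length = ℓ n :=
  hF.2.2 n k _ hk (length_modReduce _ _ _)

/-! ### The real game of `PRF^mod` and its advantage -/

/-- `prfModRealProb F κ ℓ 𝒜 n = Pr_{(k,a) ← K^mod}[𝒜^{PRF^mod_{(k,a)}}(1ⁿ) = 1]`: the acceptance
probability of the oracle adversary `𝒜` given oracle access (on queries of length `ℓ n`,
`oracleOfFnAt`) to `PRF^mod_{(k,a)}`, for a uniformly random key `(k, a) ∈ {0,1}^{κ n} × A`,
`A = zhandryModuli (2^{ℓ n})` — written as the finite average (value `0` if `A = ∅`).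
[cite: AaronsonChen2017, Def. 7.2 and Lemma 7.5 (pp. 29–30)] -/
noncomputable def prfModRealProb (F : FunctionEnsemble) (κ ℓ : ℕ → ℕ) (𝒜 : OracleAdversary Bool)
    (n : ℕ) : ℝ :=
  (∑ k : List.Vector Bool (κ n), ∑ a ∈ zhandryModuli (2 ^ ℓ n),
      𝒜.acceptProb (oracleOfFnAt (ℓ n) (prfMod F ℓ n k.toList a)) n) /
    (2 ^ κ n * ((zhandryModuli (2 ^ ℓ n)).card : ℝ))

/-- The distinguishing advantage of `𝒜` between `PRF^mod` (real game) and a uniformly random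
function `{0,1}^{ℓ n} → {0,1}^{ℓ n}` (the tree's ideal PRF game `prfIdealProb ℓ ℓ`).
[cite: AaronsonChen2017, Def. 7.2 (p. 29)] -/
noncomputable def prfModAdvantage (F : FunctionEnsemble) (κ ℓ : ℕ → ℕ) (𝒜 : OracleAdversary Bool)
    (n : ℕ) : ℝ :=
  |prfModRealProb F κ ℓ 𝒜 n - prfIdealProb ℓ ℓ 𝒜 n|

/-- `prfModRealProb` is nonnegative. [cite: AaronsonChen2017, Def. 7.2 (p. 29)] -/
theorem prfModRealProb_nonneg (F : FunctionEnsemble) (κ ℓ : ℕ → ℕ) (𝒜 : OracleAdversary Bool)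
    (n : ℕ) : 0 ≤ prfModRealProb F κ ℓ 𝒜 n := by
  unfold prfModRealProb
  refine div_nonneg (Finset.sum_nonneg fun k _ => Finset.sum_nonneg fun a _ => ?_) (by positivity)
  exact OracleAdversary.acceptProb_nonneg _ _ _

/-- `prfModRealProb` is at most `1` (an average of probabilities). [cite: AaronsonChen2017, Def. 7.2 (p. 29)] -/
theorem prfModRealProb_le_one (F : FunctionEnsemble) (κ ℓ : ℕ → ℕ) (𝒜 : OracleAdversary Bool)
    (n : ℕ) : prfModRealProb F κ ℓ 𝒜 n ≤ 1 := by
  unfold prfModRealProb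
  rcases Nat.eq_zero_or_pos (zhandryModuli (2 ^ ℓ n)).card with h0 | hpos
  · rw [Finset.card_eq_zero.1 h0]
    simp
  · rw [div_le_one (by positivity)]
    calc ∑ k : List.Vector Bool (κ n), ∑ a ∈ zhandryModuli (2 ^ ℓ n),
          𝒜.acceptProb (oracleOfFnAt (ℓ n) (prfMod F ℓ n k.toList a)) n
        ≤ ∑ _k : List.Vector Bool (κ n), ∑ _a ∈ zhandryModuli (2 ^ ℓ n), (1 : ℝ) :=
          Finset.sum_le_sum fun k _ => Finset.sum_le_sum fun a _ =>
            OracleAdversary.acceptProb_le_one _ _ _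
      _ = 2 ^ κ n * ((zhandryModuli (2 ^ ℓ n)).card : ℝ) := by
          simp [Finset.sum_const, Finset.card_univ, card_vector]

/-- The `PRF^mod` advantage is nonnegative. [cite: AaronsonChen2017, Def. 7.2 (p. 29)] -/
theorem prfModAdvantage_nonneg (F : FunctionEnsemble) (κ ℓ : ℕ → ℕ) (𝒜 : OracleAdversary Bool)
    (n : ℕ) : 0 ≤ prfModAdvantage F κ ℓ 𝒜 n :=
  abs_nonneg _

/-- The `PRF^mod` advantage is at most `1`. [cite: AaronsonChen2017, Def. 7.2 (p. 29)] -/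
theorem prfModAdvantage_le_one (F : FunctionEnsemble) (κ ℓ : ℕ → ℕ) (𝒜 : OracleAdversary Bool)
    (n : ℕ) : prfModAdvantage F κ ℓ 𝒜 n ≤ 1 := by
  unfold prfModAdvantage
  have h₁ := prfModRealProb_nonneg F κ ℓ 𝒜 n
  have h₂ := prfModRealProb_le_one F κ ℓ 𝒜 n
  have h₃ := prfIdealProb_nonneg ℓ ℓ 𝒜 n
  have h₄ := prfIdealProb_le_one ℓ ℓ 𝒜 n
  rw [abs_le]
  constructor <;> linarith

/-- **The tree's real PRF game as a finite average over the keys**: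
`prfRealProb F κ ℓ 𝒜 n = 2^{-κ n} ∑_{k ∈ {0,1}^{κ n}} Pr[𝒜^{F n k}(1ⁿ) = 1]` (the key is drawn
from `uniformBits (κ n)`, the push-forward of the uniform distribution on `List.Vector Bool (κ n)`).
[cite: Goldreich2001, Def. 3.6.4] -/
theorem prfRealProb_eq_sum (F : FunctionEnsemble) (κ ℓ : ℕ → ℕ) (𝒜 : OracleAdversary Bool) (n : ℕ) :
    prfRealProb F κ ℓ 𝒜 n =
      (∑ k : List.Vector Bool (κ n), 𝒜.acceptProb (oracleOfFnAt (ℓ n) (F n k.toList)) n) / 2 ^ κ n := by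
  rw [prfRealProb, prfRealPMF, uniformBits, PMF.bind_map, PMF.bind_apply, tsum_fintype,
    ENNReal.toReal_sum (fun k _ => ENNReal.mul_ne_top (PMF.apply_ne_top _ _) (PMF.apply_ne_top _ _)),
    Finset.sum_div]
  refine Finset.sum_congr rfl fun k _ => ?_
  rw [ENNReal.toReal_mul, PMF.uniformOfFintype_apply, card_vector, Fintype.card_bool,
    ENNReal.toReal_inv, OracleAdversary.acceptProb]
  simp [Function.comp, div_eq_inv_mul]

/-! ### Lemma 7.5 (1): the named facts -/

/-- **Aaronson–Chen 2017, Lemma 7.5 (1), first half — "a secure PRP is also a secure PRF"**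
(the PRP/PRF switching lemma, App. 13: "It is well-known that a secure PRP is also a secure PRF;
therefore `PRP^raw` is a classically-secure PRF"), for the tree's PRPs with block length `ℓ n ≥ n`
(the floor that makes the domain superpolynomial, as in `PRPExist`): such a `PRP^raw` is a PRF
in the sense of `IsPRF F κ ℓ ℓ`. Named fact (a `q`-query adversary tells a random permutation
from a random function with advantage `≤ q²/2^{ℓ n}`).
[cite: AaronsonChen2017, Lemma 7.5 (1) and App. 13 (pp. 30, 42)] -/
def aaronsonChen2017_lem75_prp_isPRF : Prop :=
  ∀ (F : FunctionEnsemble) (κ ℓ : ℕ → ℕ), IsPRP F κ ℓ → (∀ n, n ≤ ℓ n) → IsPRF F κ ℓ ℓ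

/-- **Aaronson–Chen 2017, Lemma 7.5 (1), second half — `PRF^mod` is a classically secure PRF**
(Zhandry 2012, Claim 1): for a secure `PRP^raw = F` with block length `ℓ n ≥ n`, every
probabilistic polynomial-time oracle adversary has negligible advantage in distinguishing
`PRF^mod_{(k,a)}`, `(k, a) ← {0,1}^{κ n} × A`, from a uniformly random function
`{0,1}^{ℓ n} → {0,1}^{ℓ n}`: "`|Pr_{f ← PRF^mod_{K^mod}}[A^f() = 1] − Pr_{f ← X^X}[A^f() = 1]| < ε`
for any polynomial-time algorithm `A`". Named fact (proof in print: switching `PRP^raw` to a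
random function, then "each difference can be divisible by at most two different moduli",
collision probability `O(q² log N / √N)`).
[cite: AaronsonChen2017, Lemma 7.5 (1) and App. 13 (pp. 30, 42)] -/
def aaronsonChen2017_lem75_prfMod_isPRF : Prop :=
  ∀ (F : FunctionEnsemble) (κ ℓ : ℕ → ℕ), IsPRP F κ ℓ → (∀ n, n ≤ ℓ n) →
    ∀ 𝒜 : OracleAdversary Bool, 𝒜.IsPPT encodingBoolBool →
      SuperpolynomialDecay atTop (fun n : ℕ => (n : ℝ)) (prfModAdvantage F κ ℓ 𝒜)

/-! ### "Consequently, no classical algorithm can distinguish them" (proved from the two facts) -/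

/-- **Lemma 7.5 (1), "Consequently"**: `PRP^raw` and `PRF^mod` are indistinguishable by
probabilistic polynomial-time oracle adversaries — the difference of the two real-game acceptance
probabilities is negligible (triangle inequality through the ideal random-function game).
[cite: AaronsonChen2017, Lemma 7.5 (1) (p. 30)] -/
theorem aaronsonChen2017_lem75_indist (h₁ : aaronsonChen2017_lem75_prp_isPRF)
    (h₂ : aaronsonChen2017_lem75_prfMod_isPRF) {F : FunctionEnsemble} {κ ℓ : ℕ → ℕ}
    (hF : IsPRP F κ ℓ) (hℓ : ∀ n, n ≤ ℓ n) {𝒜 : OracleAdversary Bool}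
    (h𝒜 : 𝒜.IsPPT encodingBoolBool) :
    SuperpolynomialDecay atTop (fun n : ℕ => (n : ℝ))
      (fun n => |prfRealProb F κ ℓ 𝒜 n - prfModRealProb F κ ℓ 𝒜 n|) := by
  have hsum : SuperpolynomialDecay atTop (fun n : ℕ => (n : ℝ))
      (fun n => prfAdvantage F κ ℓ ℓ 𝒜 n + prfModAdvantage F κ ℓ 𝒜 n) :=
    ((h₁ F κ ℓ hF hℓ).2 𝒜 h𝒜).add (h₂ F κ ℓ hF hℓ 𝒜 h𝒜)
  refine hsum.trans_abs_le fun n => ?_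
  rw [abs_abs]
  have htri : |prfRealProb F κ ℓ 𝒜 n - prfModRealProb F κ ℓ 𝒜 n| ≤
      prfAdvantage F κ ℓ ℓ 𝒜 n + prfModAdvantage F κ ℓ 𝒜 n := by
    unfold prfAdvantage prfModAdvantage
    calc |prfRealProb F κ ℓ 𝒜 n - prfModRealProb F κ ℓ 𝒜 n|
        = |(prfRealProb F κ ℓ 𝒜 n - prfIdealProb ℓ ℓ 𝒜 n) -
            (prfModRealProb F κ ℓ 𝒜 n - prfIdealProb ℓ ℓ 𝒜 n)| := by ring_nf
      _ ≤ |prfRealProb F κ ℓ 𝒜 n - prfIdealProb ℓ ℓ 𝒜 n| +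
            |prfModRealProb F κ ℓ 𝒜 n - prfIdealProb ℓ ℓ 𝒜 n| := abs_sub _ _
  exact htri.trans (le_abs_self _)

/-- The `ε`-form used by the diagonalization of Thm. 7.6: for every `δ > 0`, from some `n` on the
two real games differ by at most `δ`. [cite: AaronsonChen2017, Lemma 7.5 (1) and Thm. 7.6 (proof, p. 30)] -/
theorem aaronsonChen2017_lem75_eventually_le (h₁ : aaronsonChen2017_lem75_prp_isPRF)
    (h₂ : aaronsonChen2017_lem75_prfMod_isPRF) {F : FunctionEnsemble} {κ ℓ : ℕ → ℕ}
    (hF : IsPRP F κ ℓ) (hℓ : ∀ n, n ≤ ℓ n) {𝒜 : OracleAdversary Bool}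
    (h𝒜 : 𝒜.IsPPT encodingBoolBool) {δ : ℝ} (hδ : 0 < δ) :
    ∃ n₀ : ℕ, ∀ n, n₀ ≤ n → |prfRealProb F κ ℓ 𝒜 n - prfModRealProb F κ ℓ 𝒜 n| ≤ δ := by
  have h0 := (aaronsonChen2017_lem75_indist h₁ h₂ hF hℓ h𝒜) 0
  simp only [pow_zero, one_mul] at h0
  have hev : ∀ᶠ n : ℕ in atTop, |prfRealProb F κ ℓ 𝒜 n - prfModRealProb F κ ℓ 𝒜 n| < δ :=
    h0.eventually (gt_mem_nhds hδ)
  obtain ⟨n₀, hn₀⟩ := eventually_atTop.1 hev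
  exact ⟨n₀, fun n hn => (hn₀ n hn).le⟩

end Literature.Computability.Cryptography
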